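import Summits.QuantumFields.YangMills.Theorems.AllWindowsColdBoxBoxHighLineRestrictionSetCum3Slots

/-!
# U5 K3′: the ROW DECOMPOSITION of `κ₃,₀^{μ_{D′}}(X, Y; U)` — trilinear split + parity zeros as ONE identity / inequality

Free-hands helper of the κ-lineage (ym-line-fcl-p3 g27), planner ym-idea-2 g18 routing 2026-08-30T01:02:42Z («fcl-p3 g27 = K3′-SPLIT skeleton: trilinear split
✓p752770, parity survivors, remainder rows by triple Hölder, √τ transfer»); the κ₃ twin of LEAD g78's ✓`GaussRestrict.abs_tiltCum4_muSet_zero_le_rows`.  Over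
`μ_D := (volume.restrict D).withDensity (ofReal ∘ gaussWeight β H)` for a measurable SYMMETRIC `D` of positive Gaussian mass and measurable observables bounded by `B` on
`D`, in the letters (LEAD's K4′ letters of record where they overlap)
`Uᵒ a := (U a − U(−a))/2`, `Uᵉ a := (U a + U(−a))/2`, `N := Uᵒ − P` (odd cubic polynomial `P` FIRST), `Rᵉ := Uᵉ − Ve` (even polynomial vertex `Ve`),
`Q_x := X − Lx`, `Q_y := Y − Ly` (quadratic parts `Lx, Ly`), odd parts `Xo, Yo` of `X, Y`, odd cubic Taylor parts `Cx, Cy`: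

* `tiltCum3_muSet_zero_eq_zero_of_even_even_odd`, `tiltCum3_muSet_zero_eq_zero_of_odd_odd_odd` — the parity zeros of `κ₃,₀` on a symmetric `D`;
* ★★ `tiltCum3_muSet_zero_rows` (exact identity) and ★★ `abs_tiltCum3_muSet_zero_le_rows`:
  `|κ₃,₀(X,Y;U)| ≤ |κ₃,₀(Lx,Ly;Ve)| (E1: even vertices, exact Wick — w3 g41 ✓p750553/✓p750934/✓p753788, on μ_{D′} via ✓p753741-type transfers)`
  `+ |κ₃,₀(Cx,Ly;P) + κ₃,₀(Lx,Cy;P)| (E2: odd cubic vertex, exact Wick ✓p753408)`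
  `+ |κ₃,₀(Lx,Ly;Rᵉ)| + |κ₃,₀(Q_x,Y;Uᵉ) + κ₃,₀(Lx,Q_y;Uᵉ)| + |κ₃,₀(X,Y;N)| + |κ₃,₀(Q_x−Cx,Ly;P) + κ₃,₀(Lx,Q_y−Cy;P)|`
  `+ |κ₃,₀(Xo,Q_y−Yo;P) + κ₃,₀(Q_x−Xo,Yo;P)|` (remainder rows RA … RE, by triple Hölder ✓`abs_tiltExp_muSet_zero_triple_le_gaussAvg`),
  using the parity zeros `κ₃,₀(Lx,Ly;P) = κ₃,₀(Xo,Yo;P) = κ₃,₀(Q_x−Xo,Q_y−Yo;P) = 0` (`Lx, Ly, X−Xo, Y−Yo` even; `Xo, Yo, P` odd).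
  The hK3 assembler instantiates `X Y := chartPlaqCost · 1 2`, `Lx Ly := linCurvSq (plaq12At ·)`, `U := tiltU β H`, `P := −cubicVertex-polynomial` (sign free: rows
  are stated for a generic odd `P`), `Ve :=` the even polynomial vertex, `Xo := chartPlaqCostOdd`, `Cx :=` its cubic Taylor polynomial.

No definitions; standard axioms.  HONEST LABEL: helper-grade U5 prep; U5, ⟨24004⟩, ⟨24336⟩ remain OPEN; route AllWindowsColdBox is DRAFT; no crux, rung or summit is
proved; **the Yang–Mills mass gap is NOT proved by this file; no summit is proved by a line.**
-/

set_option autoImplicit false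

noncomputable section

open MeasureTheory Set

namespace Summit.QuantumFields.YangMills.Theorems.AllWindowsColdBoxBoxHighLine

namespace GaussRestrict

variable {H : ℕ} {β : ℝ}

/-! ## Parity zeros of `κ₃,₀` on a symmetric `D` -/

/-- `κ₃,₀(F, G; P) = 0` over a symmetric `D` for `F, G` even and `P` odd (any tilt letter is `P` here; measurable, bounded on `D`). -/
theorem tiltCum3_muSet_zero_eq_zero_of_even_even_odd (hβ : 0 < β) {D : Set (LandauFree H → E3)} (hDm : MeasurableSet D) (hsym : ∀ a, -a ∈ D ↔ a ∈ D)
    {F G P : (LandauFree H → E3) → ℝ} (pF : ∀ a, F (-a) = F a) (pG : ∀ a, G (-a) = G a) (pP : ∀ a, P (-a) = -P a) :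
    Tilt.tiltCum3 ((((volume : Measure (LandauFree H → E3)).restrict D).withDensity fun a => ENNReal.ofReal (gaussWeight β H a))) P 0 F G = 0 := by
  have hP : Tilt.tiltExp ((((volume : Measure (LandauFree H → E3)).restrict D).withDensity fun a => ENNReal.ofReal (gaussWeight β H a))) P 0 P = 0 :=
    tiltExp_muSet_zero_eq_zero_of_odd hβ hDm hsym P pP
  unfold Tilt.tiltCum3
  rw [hP]
  exact tiltExp_muSet_zero_eq_zero_of_odd hβ hDm hsym P fun a => by rw [pF, pG, pP]; ring

/-- `κ₃,₀(F, G; P) = 0` over a symmetric `D` for `F, G, P` all odd. -/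
theorem tiltCum3_muSet_zero_eq_zero_of_odd_odd_odd (hβ : 0 < β) {D : Set (LandauFree H → E3)} (hDm : MeasurableSet D) (hsym : ∀ a, -a ∈ D ↔ a ∈ D)
    {F G P : (LandauFree H → E3) → ℝ} (pF : ∀ a, F (-a) = -F a) (pG : ∀ a, G (-a) = -G a) (pP : ∀ a, P (-a) = -P a) :
    Tilt.tiltCum3 ((((volume : Measure (LandauFree H → E3)).restrict D).withDensity fun a => ENNReal.ofReal (gaussWeight β H a))) P 0 F G = 0 := by
  have hF : Tilt.tiltExp ((((volume : Measure (LandauFree H → E3)).restrict D).withDensity fun a => ENNReal.ofReal (gaussWeight β H a))) P 0 F = 0 :=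
    tiltExp_muSet_zero_eq_zero_of_odd hβ hDm hsym P pF
  have hG : Tilt.tiltExp ((((volume : Measure (LandauFree H → E3)).restrict D).withDensity fun a => ENNReal.ofReal (gaussWeight β H a))) P 0 G = 0 :=
    tiltExp_muSet_zero_eq_zero_of_odd hβ hDm hsym P pG
  have hP : Tilt.tiltExp ((((volume : Measure (LandauFree H → E3)).restrict D).withDensity fun a => ENNReal.ofReal (gaussWeight β H a))) P 0 P = 0 :=
    tiltExp_muSet_zero_eq_zero_of_odd hβ hDm hsym P pP
  unfold Tilt.tiltCum3
  rw [hF, hG, hP]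
  exact tiltExp_muSet_zero_eq_zero_of_odd hβ hDm hsym P fun a => by rw [pF, pG, pP]; ring

/-! ## The row decomposition -/

/-- ★★ **Row decomposition of `κ₃,₀^{μ_D}(X,Y;U)` — exact identity** (see the module docstring for the letters and the rows). -/
theorem tiltCum3_muSet_zero_rows (hβ : 0 < β) {D : Set (LandauFree H → E3)} (hDm : MeasurableSet D) (hsym : ∀ a, -a ∈ D ↔ a ∈ D)
    (hD : 0 < ∫ a, D.indicator (fun _ => (1 : ℝ)) a * gaussWeight β H a)
    {X Y U P Ve Lx Ly Cx Cy Xo Yo : (LandauFree H → E3) → ℝ} {B : ℝ} (hB : 0 ≤ B)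
    (mX : Measurable X) (mY : Measurable Y) (mU : Measurable U) (mP : Measurable P) (mVe : Measurable Ve) (mLx : Measurable Lx) (mLy : Measurable Ly)
    (mCx : Measurable Cx) (mCy : Measurable Cy) (mXo : Measurable Xo) (mYo : Measurable Yo)
    (bX : ∀ a ∈ D, |X a| ≤ B) (bY : ∀ a ∈ D, |Y a| ≤ B) (bU : ∀ a ∈ D, |U a| ≤ B) (bU' : ∀ a ∈ D, |U (-a)| ≤ B) (bP : ∀ a ∈ D, |P a| ≤ B)
    (bVe : ∀ a ∈ D, |Ve a| ≤ B) (bLx : ∀ a ∈ D, |Lx a| ≤ B) (bLy : ∀ a ∈ D, |Ly a| ≤ B) (bCx : ∀ a ∈ D, |Cx a| ≤ B) (bCy : ∀ a ∈ D, |Cy a| ≤ B)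
    (bXo : ∀ a ∈ D, |Xo a| ≤ B) (bYo : ∀ a ∈ D, |Yo a| ≤ B)
    (pLx : ∀ a, Lx (-a) = Lx a) (pLy : ∀ a, Ly (-a) = Ly a) (pXo : ∀ a, Xo (-a) = -Xo a) (pYo : ∀ a, Yo (-a) = -Yo a) (pP : ∀ a, P (-a) = -P a)
    (pXe : ∀ a, X (-a) - Xo (-a) = X a - Xo a) (pYe : ∀ a, Y (-a) - Yo (-a) = Y a - Yo a) :
    let μD : Measure (LandauFree H → E3) := (((volume : Measure (LandauFree H → E3)).restrict D).withDensity fun a => ENNReal.ofReal (gaussWeight β H a))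
    let Ue : (LandauFree H → E3) → ℝ := fun a => (U a + U (-a)) / 2
    let N : (LandauFree H → E3) → ℝ := fun a => (U a - U (-a)) / 2 - P a
    let Re : (LandauFree H → E3) → ℝ := fun a => (U a + U (-a)) / 2 - Ve a
    Tilt.tiltCum3 μD U 0 X Y =
      Tilt.tiltCum3 μD Ve 0 Lx Ly +
      (Tilt.tiltCum3 μD P 0 Cx Ly + Tilt.tiltCum3 μD P 0 Lx Cy) +
      Tilt.tiltCum3 μD Re 0 Lx Ly +
      (Tilt.tiltCum3 μD Ue 0 (fun a => X a - Lx a) Y + Tilt.tiltCum3 μD Ue 0 Lx (fun a => Y a - Ly a)) +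
      Tilt.tiltCum3 μD N 0 X Y +
      (Tilt.tiltCum3 μD P 0 (fun a => X a - Lx a - Cx a) Ly + Tilt.tiltCum3 μD P 0 Lx (fun a => Y a - Ly a - Cy a)) +
      (Tilt.tiltCum3 μD P 0 Xo (fun a => Y a - Ly a - Yo a) + Tilt.tiltCum3 μD P 0 (fun a => X a - Lx a - Xo a) Yo) := by
  intro μD Ue N Re
  let Uo : (LandauFree H → E3) → ℝ := fun a => (U a - U (-a)) / 2
  -- bounds on `D` (everything by `2B`, products of three by `3B`… we use `2B` and `3B` where needed)
  have h2B : 0 ≤ 2 * B := by linarith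
  have h3B : 0 ≤ 3 * B := by linarith
  have up : ∀ {G : (LandauFree H → E3) → ℝ}, (∀ a ∈ D, |G a| ≤ B) → ∀ a ∈ D, |G a| ≤ 3 * B := fun {G} h a ha => (h a ha).trans (by linarith)
  have bUo : ∀ a ∈ D, |Uo a| ≤ 3 * B := fun a ha => by
    show |(U a - U (-a)) / 2| ≤ 3 * B
    rw [abs_div, abs_two]; linarith [abs_sub (U a) (U (-a)), bU a ha, bU' a ha]
  have bUe : ∀ a ∈ D, |Ue a| ≤ 3 * B := fun a ha => by
    show |(U a + U (-a)) / 2| ≤ 3 * B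
    rw [abs_div, abs_two]; linarith [abs_add_le (U a) (U (-a)), bU a ha, bU' a ha]
  have bN : ∀ a ∈ D, |N a| ≤ 3 * B := fun a ha => by
    show |(U a - U (-a)) / 2 - P a| ≤ 3 * B
    have h1 : |(U a - U (-a)) / 2| ≤ B := by rw [abs_div, abs_two]; linarith [abs_sub (U a) (U (-a)), bU a ha, bU' a ha]
    linarith [abs_sub ((U a - U (-a)) / 2) (P a), bP a ha]
  have bRe : ∀ a ∈ D, |Re a| ≤ 3 * B := fun a ha => by
    show |(U a + U (-a)) / 2 - Ve a| ≤ 3 * B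
    have h1 : |(U a + U (-a)) / 2| ≤ B := by rw [abs_div, abs_two]; linarith [abs_add_le (U a) (U (-a)), bU a ha, bU' a ha]
    linarith [abs_sub ((U a + U (-a)) / 2) (Ve a), bVe a ha]
  have bQx : ∀ a ∈ D, |X a - Lx a| ≤ 3 * B := fun a ha => by linarith [abs_sub (X a) (Lx a), bX a ha, bLx a ha]
  have bQy : ∀ a ∈ D, |Y a - Ly a| ≤ 3 * B := fun a ha => by linarith [abs_sub (Y a) (Ly a), bY a ha, bLy a ha]
  have bQCx : ∀ a ∈ D, |X a - Lx a - Cx a| ≤ 3 * B := fun a ha => by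
    linarith [abs_sub (X a - Lx a) (Cx a), abs_sub (X a) (Lx a), bX a ha, bLx a ha, bCx a ha]
  have bQCy : ∀ a ∈ D, |Y a - Ly a - Cy a| ≤ 3 * B := fun a ha => by
    linarith [abs_sub (Y a - Ly a) (Cy a), abs_sub (Y a) (Ly a), bY a ha, bLy a ha, bCy a ha]
  have bQOx : ∀ a ∈ D, |X a - Lx a - Xo a| ≤ 3 * B := fun a ha => by
    linarith [abs_sub (X a - Lx a) (Xo a), abs_sub (X a) (Lx a), bX a ha, bLx a ha, bXo a ha]
  have bQOy : ∀ a ∈ D, |Y a - Ly a - Yo a| ≤ 3 * B := fun a ha => by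
    linarith [abs_sub (Y a - Ly a) (Yo a), abs_sub (Y a) (Ly a), bY a ha, bLy a ha, bYo a ha]
  -- measurability
  have mneg : Measurable fun a : LandauFree H → E3 => U (-a) := mU.comp measurable_neg
  have mUo : Measurable Uo := (mU.sub mneg).div_const 2
  have mUe : Measurable Ue := (mU.add mneg).div_const 2
  have mN : Measurable N := ((mU.sub mneg).div_const 2).sub mP
  have mRe : Measurable Re := ((mU.add mneg).div_const 2).sub mVe
  have mQx : Measurable fun a => X a - Lx a := mX.sub mLx
  have mQy : Measurable fun a => Y a - Ly a := mY.sub mLy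
  have mQCx : Measurable fun a => X a - Lx a - Cx a := (mX.sub mLx).sub mCx
  have mQCy : Measurable fun a => Y a - Ly a - Cy a := (mY.sub mLy).sub mCy
  have mQOx : Measurable fun a => X a - Lx a - Xo a := (mX.sub mLx).sub mXo
  have mQOy : Measurable fun a => Y a - Ly a - Yo a := (mY.sub mLy).sub mYo
  -- (1) `U = Uᵉ + Uᵒ` in the third slot
  have eU : (fun a => Ue a + Uo a) = U := funext fun a => by show (U a + U (-a)) / 2 + (U a - U (-a)) / 2 = U a; ring
  have s1 : Tilt.tiltCum3 μD U 0 X Y = Tilt.tiltCum3 μD (fun a => Ue a + Uo a) 0 X Y := by rw [eU]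
  have h1 := tiltCum3_muSet_zero_add_third hβ hDm hD h3B mX mY mUe mUo (up bX) (up bY) bUe bUo
  -- (2) `Uᵉ = Ve + Rᵉ` on `(Lx, Ly)`; first peel `X = Lx + Q_x`, `Y = Ly + Q_y` in the `Uᵉ` cumulant
  have eX : (fun a => Lx a + (X a - Lx a)) = X := funext fun a => by ring
  have eY : (fun a => Ly a + (Y a - Ly a)) = Y := funext fun a => by ring
  have s2 : Tilt.tiltCum3 μD Ue 0 X Y = Tilt.tiltCum3 μD Ue 0 (fun a => Lx a + (X a - Lx a)) Y := by rw [eX]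
  have h2 := tiltCum3_muSet_zero_add_left hβ hDm hD Ue h3B mLx mQx mY mUe (up bLx) bQx (up bY) bUe
  have s3 : Tilt.tiltCum3 μD Ue 0 Lx Y = Tilt.tiltCum3 μD Ue 0 Lx (fun a => Ly a + (Y a - Ly a)) := by rw [eY]
  have h3 := tiltCum3_muSet_zero_add_right hβ hDm hD Ue h3B mLx mLy mQy mUe (up bLx) (up bLy) bQy bUe
  have eUe : (fun a => Ve a + Re a) = Ue := funext fun a => by show Ve a + ((U a + U (-a)) / 2 - Ve a) = (U a + U (-a)) / 2; ring
  have s4 : Tilt.tiltCum3 μD Ue 0 Lx Ly = Tilt.tiltCum3 μD (fun a => Ve a + Re a) 0 Lx Ly := by rw [eUe]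
  have h4 := tiltCum3_muSet_zero_add_third hβ hDm hD h3B mLx mLy mVe mRe (up bLx) (up bLy) (up bVe) bRe
  -- (3) `Uᵒ = P + N`
  have eUo : (fun a => P a + N a) = Uo := funext fun a => by show P a + ((U a - U (-a)) / 2 - P a) = (U a - U (-a)) / 2; ring
  have s5 : Tilt.tiltCum3 μD Uo 0 X Y = Tilt.tiltCum3 μD (fun a => P a + N a) 0 X Y := by rw [eUo]
  have h5 := tiltCum3_muSet_zero_add_third hβ hDm hD h3B mX mY mP mN (up bX) (up bY) (up bP) bN
  -- (4) the `P` cumulant: `X = Lx + Q_x`, `Y = Ly + Q_y`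
  have s6 : Tilt.tiltCum3 μD P 0 X Y = Tilt.tiltCum3 μD P 0 (fun a => Lx a + (X a - Lx a)) Y := by rw [eX]
  have h6 := tiltCum3_muSet_zero_add_left hβ hDm hD P h3B mLx mQx mY mP (up bLx) bQx (up bY) (up bP)
  have s7 : Tilt.tiltCum3 μD P 0 Lx Y = Tilt.tiltCum3 μD P 0 Lx (fun a => Ly a + (Y a - Ly a)) := by rw [eY]
  have h7 := tiltCum3_muSet_zero_add_right hβ hDm hD P h3B mLx mLy mQy mP (up bLx) (up bLy) bQy (up bP)
  have s8 : Tilt.tiltCum3 μD P 0 (fun a => X a - Lx a) Y = Tilt.tiltCum3 μD P 0 (fun a => X a - Lx a) (fun a => Ly a + (Y a - Ly a)) := by rw [eY]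
  have h8 := tiltCum3_muSet_zero_add_right hβ hDm hD P h3B mQx mLy mQy mP bQx (up bLy) bQy (up bP)
  -- parity zero `κ₃(Lx,Ly;P) = 0`
  have z1 : Tilt.tiltCum3 μD P 0 Lx Ly = 0 := tiltCum3_muSet_zero_eq_zero_of_even_even_odd hβ hDm hsym pLx pLy pP
  -- (5) peel the cubic Taylor parts: `Q_x = Cx + (Q_x − Cx)`, `Q_y = Cy + (Q_y − Cy)`
  have eQx : (fun a => Cx a + (X a - Lx a - Cx a)) = fun a => X a - Lx a := funext fun a => by ring
  have s9 : Tilt.tiltCum3 μD P 0 (fun a => X a - Lx a) Ly = Tilt.tiltCum3 μD P 0 (fun a => Cx a + (X a - Lx a - Cx a)) Ly := by rw [eQx]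
  have h9 := tiltCum3_muSet_zero_add_left hβ hDm hD P h3B mCx mQCx mLy mP (up bCx) bQCx (up bLy) (up bP)
  have eQy : (fun a => Cy a + (Y a - Ly a - Cy a)) = fun a => Y a - Ly a := funext fun a => by ring
  have s10 : Tilt.tiltCum3 μD P 0 Lx (fun a => Y a - Ly a) = Tilt.tiltCum3 μD P 0 Lx (fun a => Cy a + (Y a - Ly a - Cy a)) := by rw [eQy]
  have h10 := tiltCum3_muSet_zero_add_right hβ hDm hD P h3B mLx mCy mQCy mP (up bLx) (up bCy) bQCy (up bP)
  -- (6) the `Q_x Q_y P` term: `Q_x = Xo + (Q_x − Xo)`, `Q_y = Yo + (Q_y − Yo)`, with two parity zeros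
  have eOx : (fun a => Xo a + (X a - Lx a - Xo a)) = fun a => X a - Lx a := funext fun a => by ring
  have eOy : (fun a => Yo a + (Y a - Ly a - Yo a)) = fun a => Y a - Ly a := funext fun a => by ring
  have s11 : Tilt.tiltCum3 μD P 0 (fun a => X a - Lx a) (fun a => Y a - Ly a) =
      Tilt.tiltCum3 μD P 0 (fun a => Xo a + (X a - Lx a - Xo a)) (fun a => Y a - Ly a) := by rw [eOx]
  have h11 := tiltCum3_muSet_zero_add_left hβ hDm hD P h3B mXo mQOx mQy mP (up bXo) bQOx bQy (up bP)
  have s12 : Tilt.tiltCum3 μD P 0 Xo (fun a => Y a - Ly a) = Tilt.tiltCum3 μD P 0 Xo (fun a => Yo a + (Y a - Ly a - Yo a)) := by rw [eOy]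
  have h12 := tiltCum3_muSet_zero_add_right hβ hDm hD P h3B mXo mYo mQOy mP (up bXo) (up bYo) bQOy (up bP)
  have s13 : Tilt.tiltCum3 μD P 0 (fun a => X a - Lx a - Xo a) (fun a => Y a - Ly a) =
      Tilt.tiltCum3 μD P 0 (fun a => X a - Lx a - Xo a) (fun a => Yo a + (Y a - Ly a - Yo a)) := by rw [eOy]
  have h13 := tiltCum3_muSet_zero_add_right hβ hDm hD P h3B mQOx mYo mQOy mP bQOx (up bYo) bQOy (up bP)
  have z2 : Tilt.tiltCum3 μD P 0 Xo Yo = 0 := tiltCum3_muSet_zero_eq_zero_of_odd_odd_odd hβ hDm hsym pXo pYo pP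
  have pQOx : ∀ a, X (-a) - Lx (-a) - Xo (-a) = X a - Lx a - Xo a := fun a => by rw [pLx]; linarith [pXe a]
  have pQOy : ∀ a, Y (-a) - Ly (-a) - Yo (-a) = Y a - Ly a - Yo a := fun a => by rw [pLy]; linarith [pYe a]
  have z3 : Tilt.tiltCum3 μD P 0 (fun a => X a - Lx a - Xo a) (fun a => Y a - Ly a - Yo a) = 0 :=
    tiltCum3_muSet_zero_eq_zero_of_even_even_odd hβ hDm hsym pQOx pQOy pP
  -- compose
  rw [s1, h1, s2, h2, s3, h3, s4, h4, s5, h5, s6, h6, s7, h7, z1, s8, h8, s9, h9, s10, h10, s11, h11, s12, h12, z2, s13, h13, z3]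
  ring

/-- ★★ **Row decomposition of `κ₃,₀^{μ_D}(X,Y;U)` — the inequality** (E1, E2 exact rows; RA … RE remainder rows). -/
theorem abs_tiltCum3_muSet_zero_le_rows (hβ : 0 < β) {D : Set (LandauFree H → E3)} (hDm : MeasurableSet D) (hsym : ∀ a, -a ∈ D ↔ a ∈ D)
    (hD : 0 < ∫ a, D.indicator (fun _ => (1 : ℝ)) a * gaussWeight β H a)
    {X Y U P Ve Lx Ly Cx Cy Xo Yo : (LandauFree H → E3) → ℝ} {B : ℝ} (hB : 0 ≤ B)
    (mX : Measurable X) (mY : Measurable Y) (mU : Measurable U) (mP : Measurable P) (mVe : Measurable Ve) (mLx : Measurable Lx) (mLy : Measurable Ly)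
    (mCx : Measurable Cx) (mCy : Measurable Cy) (mXo : Measurable Xo) (mYo : Measurable Yo)
    (bX : ∀ a ∈ D, |X a| ≤ B) (bY : ∀ a ∈ D, |Y a| ≤ B) (bU : ∀ a ∈ D, |U a| ≤ B) (bU' : ∀ a ∈ D, |U (-a)| ≤ B) (bP : ∀ a ∈ D, |P a| ≤ B)
    (bVe : ∀ a ∈ D, |Ve a| ≤ B) (bLx : ∀ a ∈ D, |Lx a| ≤ B) (bLy : ∀ a ∈ D, |Ly a| ≤ B) (bCx : ∀ a ∈ D, |Cx a| ≤ B) (bCy : ∀ a ∈ D, |Cy a| ≤ B)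
    (bXo : ∀ a ∈ D, |Xo a| ≤ B) (bYo : ∀ a ∈ D, |Yo a| ≤ B)
    (pLx : ∀ a, Lx (-a) = Lx a) (pLy : ∀ a, Ly (-a) = Ly a) (pXo : ∀ a, Xo (-a) = -Xo a) (pYo : ∀ a, Yo (-a) = -Yo a) (pP : ∀ a, P (-a) = -P a)
    (pXe : ∀ a, X (-a) - Xo (-a) = X a - Xo a) (pYe : ∀ a, Y (-a) - Yo (-a) = Y a - Yo a) :
    let μD : Measure (LandauFree H → E3) := (((volume : Measure (LandauFree H → E3)).restrict D).withDensity fun a => ENNReal.ofReal (gaussWeight β H a))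
    let Ue : (LandauFree H → E3) → ℝ := fun a => (U a + U (-a)) / 2
    let N : (LandauFree H → E3) → ℝ := fun a => (U a - U (-a)) / 2 - P a
    let Re : (LandauFree H → E3) → ℝ := fun a => (U a + U (-a)) / 2 - Ve a
    |Tilt.tiltCum3 μD U 0 X Y| ≤
      |Tilt.tiltCum3 μD Ve 0 Lx Ly| +
      |Tilt.tiltCum3 μD P 0 Cx Ly + Tilt.tiltCum3 μD P 0 Lx Cy| +
      |Tilt.tiltCum3 μD Re 0 Lx Ly| +
      |Tilt.tiltCum3 μD Ue 0 (fun a => X a - Lx a) Y + Tilt.tiltCum3 μD Ue 0 Lx (fun a => Y a - Ly a)| +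
      |Tilt.tiltCum3 μD N 0 X Y| +
      |Tilt.tiltCum3 μD P 0 (fun a => X a - Lx a - Cx a) Ly + Tilt.tiltCum3 μD P 0 Lx (fun a => Y a - Ly a - Cy a)| +
      |Tilt.tiltCum3 μD P 0 Xo (fun a => Y a - Ly a - Yo a) + Tilt.tiltCum3 μD P 0 (fun a => X a - Lx a - Xo a) Yo| := by
  intro μD Ue N Re
  have key := tiltCum3_muSet_zero_rows hβ hDm hsym hD hB mX mY mU mP mVe mLx mLy mCx mCy mXo mYo bX bY bU bU' bP bVe bLx bLy bCx bCy bXo bYo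
    pLx pLy pXo pYo pP pXe pYe
  simp only at key
  rw [show Tilt.tiltCum3 μD U 0 X Y = _ from key]
  have tri : ∀ (a₁ a₂ a₃ a₄ a₅ a₆ a₇ : ℝ), |a₁ + a₂ + a₃ + a₄ + a₅ + a₆ + a₇| ≤ |a₁| + |a₂| + |a₃| + |a₄| + |a₅| + |a₆| + |a₇| := by
    intro a₁ a₂ a₃ a₄ a₅ a₆ a₇
    linarith [abs_add_le (a₁ + a₂ + a₃ + a₄ + a₅ + a₆) a₇, abs_add_le (a₁ + a₂ + a₃ + a₄ + a₅) a₆, abs_add_le (a₁ + a₂ + a₃ + a₄) a₅,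
      abs_add_le (a₁ + a₂ + a₃) a₄, abs_add_le (a₁ + a₂) a₃, abs_add_le a₁ a₂]
  exact tri _ _ _ _ _ _ _

end GaussRestrict

end Summit.QuantumFields.YangMills.Theorems.AllWindowsColdBoxBoxHighLine

end
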